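import Mathlib
import Literature.NumberTheory.Irrationality.CressonFischlerRivoal2008.WellPoisedSymmetry
import Summits.KontsevichZagierPeriods.Zeta5Search.LaiBoxReflection
import HarnessLib

/-!
# The twisted odd-zeta family `T`: reflection law and "forms in odd zeta values" (exact, all parameters)

HONEST FRAMING: systematic search; no irrationality claim unless certified.  Cell `pub-zeta5`, lane
`families/odd` (FAMILY.md v2.1 §5.7–§5.10; TWISTED-LEMMA19.md).  This file proves EXACT algebraic laws and the
hypothesis-free Cresson–Fischler–Rivoal consequence; nothing asymptotic or arithmetic (the denominator lemma
T19 and every rate `κ` stay paper/FLOAT level).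

The family (T-normalisation of `code/famodd/twist_family.py`): integers `h₀, e ≥ 0`, bricks `h_j` with
`2 h_j ≤ h₀` (`j < q`), and the summand (up to a non-zero constant in `t`, which only rescales the coefficients)
`R(t) = (2t − 2e)_{2h₀+4e+1} / ∏_j (t + h_j)_{h₀ − 2h_j + 1}`.
The denominator is Lai's block denominator at `n = 1`, `M = h₀`, `δ_j = h_j` (tree file `LaiBoxReflection`:
`laiDen q h₀ 1 h`), so its reflection law is imported; the new input is the TWISTED numerator, a Pochhammer
string in `2t` of odd length centred at `t = −h₀/2`, which is ODD under `t ↦ −t − h₀` for every `e`.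

Main results (every `t : ℚ`; Lean's `x / 0 = 0` makes the poles harmless):
* `twistNum_reflect` : `(2(−t−h₀) − 2e)_{2h₀+4e+1} = −(2t − 2e)_{2h₀+4e+1}`;
* `twistNum_natCast_eq_zero` : `R(m) = 0` for the integers `0 ≤ m ≤ e` (so `Σ_{t ≥ e+1} R(t) = Σ_{t ≥ 1} R(t)`);
* `twistCore_reflect` : `R(−t − h₀) = −(∏_j (−1)^{(h₀−2h_j)+1}) · R(t)`;
* `twistCore_reflect_even` : an EVEN number `q` of bricks ⇒ `R(−t − h₀) = −R(t)` for all `h₀, e`;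
* `twistCore_reflect_odd` : an ODD number of bricks ⇒ `R(−t − h₀) = (−1)^{h₀} R(t)` (antisymmetry iff `h₀` odd:
  the parity rule of FAMILY.md §5.4 D1 / §8);
* `twistBox_hasSum_oddZeta` : for even `q ≥ 1`, `2h_j ≤ h₀` and the degree condition
  `2h₀ + 4e + 3 + Σ_j 2h_j ≤ q (h₀ + 1)`, the series `Σ_{k ≥ 0} R(k+1)` converges to
  `a₀ + Σ_{3 ≤ s ≤ q, s odd} a_s ζ(s)` with `a_s ∈ ℚ` — PROVED from the tree theorem
  `CressonFischlerRivoal2008.theoreme1_holds` (for even `q` the top value is `ζ(q−1)`).  The companion series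
  `Σ R(k + ½)` (forms in `(2^s − 1)ζ(s)`) would need a half-integer analogue of CFR Théorème 1, which the tree
  does not have; it is not treated here.
-/

namespace Summit.KontsevichZagierPeriods.Zeta5Search

open Finset

/-- The twisted numerator `(2t − 2e)_{2h₀+4e+1} = ∏_{i=0}^{2h₀+4e} (2t − 2e + i)`. [this file; FAMILY.md §5.7] -/
def twistNum (h₀ e : ℕ) (t : ℚ) : ℚ :=
  ∏ i ∈ range (2 * h₀ + 4 * e + 1), (2 * t - 2 * (e : ℚ) + (i : ℚ))

/-- The twisted summand up to its constant: `(2t − 2e)_{2h₀+4e+1} / ∏_j (t + h_j)_{h₀−2h_j+1}`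
(denominator = Lai's block denominator at `n = 1`). [this file] -/
def twistCore (q h₀ e : ℕ) (h : Fin q → ℕ) (t : ℚ) : ℚ :=
  twistNum h₀ e t / laiDen q h₀ 1 h t

/-- The twisted numerator is ODD under `t ↦ −t − h₀` (an odd-length string reflects onto itself). [this file] -/
theorem twistNum_reflect (h₀ e : ℕ) (t : ℚ) : twistNum h₀ e (-t - h₀) = -twistNum h₀ e t := by
  unfold twistNum
  set N := 2 * h₀ + 4 * e + 1 with hN
  have h1 : ∀ i ∈ range N, (2 * (-t - (h₀ : ℚ)) - 2 * (e : ℚ) + (i : ℚ)) =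
      -(2 * t - 2 * (e : ℚ) + ((N - 1 - i : ℕ) : ℚ)) := by
    intro i hi
    have hi' : i < N := mem_range.mp hi
    have e1 : ((N - 1 - i : ℕ) : ℚ) = (N : ℚ) - 1 - i := by
      rw [Nat.sub_sub, Nat.cast_sub (by omega)]; push_cast; ring
    rw [e1, hN]; push_cast; ring
  have hr : ∏ i ∈ range N, (2 * t - 2 * (e : ℚ) + ((N - 1 - i : ℕ) : ℚ)) =
      ∏ i ∈ range N, (2 * t - 2 * (e : ℚ) + (i : ℚ)) :=
    prod_range_reflect (fun i => 2 * t - 2 * (e : ℚ) + (i : ℚ)) N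
  rw [prod_congr rfl h1, prod_range_neg, hr]
  have hodd : Odd N := ⟨h₀ + 2 * e, by omega⟩
  rw [hodd.neg_one_pow]; ring

/-- The twisted numerator vanishes at the integers `0 ≤ m ≤ e` (the factor `i = 2e − 2m`), so the family's
series `Σ_{t ≥ e+1} R(t)` equals `Σ_{t ≥ 1} R(t)`. [this file] -/
theorem twistNum_natCast_eq_zero (h₀ e m : ℕ) (hm : m ≤ e) : twistNum h₀ e (m : ℚ) = 0 := by
  unfold twistNum
  apply prod_eq_zero (i := 2 * e - 2 * m) (mem_range.mpr (by omega))
  rw [Nat.cast_sub (by omega)]; push_cast; ring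

/-- **Reflection law** of the twisted summand, all parameters with `2h_j ≤ h₀`:
`R(−t − h₀) = −(∏_j (−1)^{(h₀−2h_j)·1+1}) · R(t)`. [this file] -/
theorem twistCore_reflect (q h₀ e : ℕ) (h : Fin q → ℕ) (hh : ∀ j, 2 * h j ≤ h₀) (t : ℚ) :
    twistCore q h₀ e h (-t - h₀) =
      -(∏ j, (-1 : ℚ) ^ ((h₀ - 2 * h j) * 1 + 1)) * twistCore q h₀ e h t := by
  unfold twistCore
  set S : ℚ := ∏ j, (-1 : ℚ) ^ ((h₀ - 2 * h j) * 1 + 1) with hS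
  have hden : laiDen q h₀ 1 h (-t - (h₀ : ℚ)) = S * laiDen q h₀ 1 h t := by
    have := laiDen_reflect q h₀ 1 h hh t
    rw [show (-t - (h₀ : ℚ) * ((1 : ℕ) : ℚ)) = -t - (h₀ : ℚ) by push_cast; ring] at this
    exact this
  have hSS : S * S = 1 := by
    rw [hS, ← prod_mul_distrib, prod_eq_one]
    intro j _
    rw [← mul_pow]; norm_num
  have hSinv : S⁻¹ = S := inv_eq_of_mul_eq_one_right hSS
  rw [twistNum_reflect, hden, div_mul_eq_div_div_swap, div_eq_mul_inv _ S, hSinv]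
  ring

/-- **Even number of bricks**: `R(−t − h₀) = −R(t)` for every `h₀, e` — the well-poised antisymmetry that (with
`deg ≤ −2`, via CFR Théorème 1) removes the even zeta values. [this file] -/
theorem twistCore_reflect_even (q h₀ e : ℕ) (h : Fin q → ℕ) (hh : ∀ j, 2 * h j ≤ h₀) (hq : Even q)
    (t : ℚ) : twistCore q h₀ e h (-t - h₀) = -twistCore q h₀ e h t := by
  rw [twistCore_reflect q h₀ e h hh t]
  have hS : (∏ j, (-1 : ℚ) ^ ((h₀ - 2 * h j) * 1 + 1)) = 1 := by
    rw [prod_congr rfl (fun j _ => blockSign_eq h₀ (h j) 1 (hh j)), prod_const, Finset.card_univ,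
      Fintype.card_fin, ← pow_mul]
    exact Even.neg_one_pow (hq.mul_left _)
  rw [hS]; ring

/-- **Odd number of bricks**: `R(−t − h₀) = (−1)^{h₀} R(t)`, so the antisymmetry holds iff `h₀` is odd
(FAMILY.md D1: an odd brick count is admissible only with `h₀` odd). [this file] -/
theorem twistCore_reflect_odd (q h₀ e : ℕ) (h : Fin q → ℕ) (hh : ∀ j, 2 * h j ≤ h₀) (hq : Odd q)
    (t : ℚ) : twistCore q h₀ e h (-t - h₀) = (-1) ^ h₀ * twistCore q h₀ e h t := by
  rw [twistCore_reflect q h₀ e h hh t]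
  have hS : (∏ j, (-1 : ℚ) ^ ((h₀ - 2 * h j) * 1 + 1)) = (-1) ^ (h₀ + 1) := by
    rw [prod_congr rfl (fun j _ => blockSign_eq h₀ (h j) 1 (hh j)), prod_const, Finset.card_univ,
      Fintype.card_fin, ← pow_mul, Nat.mul_one]
    obtain ⟨k, hk⟩ := hq
    rw [hk, Nat.mul_add, Nat.mul_one, pow_add, pow_mul]
    have : ((-1 : ℚ) ^ (h₀ + 1)) ^ (2 * k) = 1 := by
      rw [← pow_mul, show (h₀ + 1) * (2 * k) = 2 * ((h₀ + 1) * k) by ring, pow_mul]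
      norm_num
    rw [this, one_mul]
  rw [hS, pow_succ]; ring

/-! ## Hook-up with Cresson–Fischler–Rivoal, Théorème 1 (tree theorem `theoreme1_holds`)

Normal form `R(t) = P(t)/(t)_{h₀+1}^q` with `P = twistNum · ∏_j c_j ∈ ℚ[X]`, `c_j = laiCof h₀ h_j 1`
(the side factor completing a brick to the full Pochhammer, tree lemma `poch_split`). -/

section CFR

open Polynomial Literature.NumberTheory.Irrationality.CressonFischlerRivoal2008
open Literature.NumberTheory.Transcendental (zetaValue)

variable {q h₀ e : ℕ} {h : Fin q → ℕ}

/-- CFR normal-form numerator `P = twistNum · ∏_j c_j` as an element of `ℚ[X]`. [this file] -/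
noncomputable def twistPoly (q h₀ e : ℕ) (h : Fin q → ℕ) : ℚ[X] :=
  (∏ i ∈ range (2 * h₀ + 4 * e + 1), (C 2 * X - C (2 * (e : ℚ)) + C (i : ℚ))) *
    ∏ j, ((∏ i ∈ range (h j * 1), (X + C (i : ℚ))) *
      ∏ i ∈ range (h j * 1), (X + C (((h₀ : ℚ) - h j) * ((1 : ℕ) : ℚ) + 1) + C (i : ℚ)))

/-- `P(t) = twistNum(t) · ∏_j c_j(t)`. [this file] -/
theorem twistPoly_eval (t : ℚ) :
    (twistPoly q h₀ e h).eval t = twistNum h₀ e t * ∏ j, laiCof h₀ (h j) 1 t := by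
  simp [twistPoly, twistNum, laiCof, eval_prod]

/-- `deg P ≤ (2h₀ + 4e + 1) + Σ_j 2h_j`. [this file] -/
theorem twistPoly_natDegree_le :
    (twistPoly q h₀ e h).natDegree ≤ (2 * h₀ + 4 * e + 1) + ∑ j, 2 * (h j * 1) := by
  unfold twistPoly
  have hA : (∏ i ∈ range (2 * h₀ + 4 * e + 1), (C (2 : ℚ) * X - C (2 * (e : ℚ)) + C (i : ℚ))).natDegree ≤
      2 * h₀ + 4 * e + 1 := by
    simpa using natDegree_prod_le_card (range (2 * h₀ + 4 * e + 1))
      (fun i : ℕ => C (2 : ℚ) * X - C (2 * (e : ℚ)) + C (i : ℚ))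
      (fun i => by
        rw [sub_eq_add_neg, ← C_neg, add_assoc, ← C_add]
        exact natDegree_linear_le)
  have hC : ∀ j, ((∏ i ∈ range (h j * 1), (X + C (i : ℚ))) *
      ∏ i ∈ range (h j * 1), (X + C (((h₀ : ℚ) - h j) * ((1 : ℕ) : ℚ) + 1) + C (i : ℚ))).natDegree ≤
      2 * (h j * 1) := by
    intro j
    refine (natDegree_mul_le).trans ?_
    have h1 : (∏ i ∈ range (h j * 1), (X + C (i : ℚ))).natDegree ≤ h j * 1 := by
      simpa using natDegree_prod_le_card (range (h j * 1)) (fun i : ℕ => X + C (i : ℚ))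
        (fun i => by rw [natDegree_X_add_C])
    have h2 : (∏ i ∈ range (h j * 1),
        (X + C (((h₀ : ℚ) - h j) * ((1 : ℕ) : ℚ) + 1) + C (i : ℚ))).natDegree ≤ h j * 1 := by
      simpa using natDegree_prod_le_card (range (h j * 1))
        (fun i : ℕ => X + C (((h₀ : ℚ) - h j) * ((1 : ℕ) : ℚ) + 1) + C (i : ℚ))
        (fun i => by rw [add_assoc, ← C_add, natDegree_X_add_C])
    omega
  have hD : (∏ j, ((∏ i ∈ range (h j * 1), (X + C (i : ℚ))) *
      ∏ i ∈ range (h j * 1), (X + C (((h₀ : ℚ) - h j) * ((1 : ℕ) : ℚ) + 1) + C (i : ℚ)))).natDegree ≤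
      ∑ j, 2 * (h j * 1) :=
    (natDegree_prod_le _ _).trans (Finset.sum_le_sum (fun j _ => hC j))
  exact natDegree_mul_le.trans (Nat.add_le_add hA hD)

/-- **Well-poised symmetry of the normal-form numerator**, CFR shape: for even `q`,
`P(−h₀ − X) = (−1)^{q(h₀+1)+1} P(X)`. [this file] -/
theorem twistPoly_symm (hq : Even q) :
    (twistPoly q h₀ e h).comp (-((h₀ * 1 : ℕ) : ℚ[X]) - X) =
      (-1 : ℚ[X]) ^ (q * (h₀ * 1 + 1) + 1) * twistPoly q h₀ e h := by
  have hsign : (-1 : ℚ[X]) ^ (q * (h₀ * 1 + 1) + 1) = -1 := by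
    rw [pow_succ, (hq.mul_right _).neg_one_pow]; ring
  rw [hsign]
  apply Polynomial.funext
  intro t
  rw [eval_comp]
  simp only [eval_sub, eval_neg, eval_X, eval_natCast, eval_mul, eval_one, eval_neg, twistPoly_eval]
  have ht : (-((h₀ * 1 : ℕ) : ℚ) - t) = -t - (h₀ : ℚ) := by push_cast; ring
  have hc : ∀ j, laiCof h₀ (h j) 1 (-t - (h₀ : ℚ)) = laiCof h₀ (h j) 1 t := by
    intro j
    have := laiCof_reflect h₀ (h j) 1 t
    rw [show (-t - (h₀ : ℚ) * ((1 : ℕ) : ℚ)) = -t - (h₀ : ℚ) by push_cast; ring] at this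
    exact this
  rw [ht, twistNum_reflect, prod_congr rfl (fun j _ => hc j)]
  ring

/-- **Twisted-family forms lie in `ℚ + Σ_{odd s} ℚ ζ(s)`** (hypothesis-free; CFR Théorème 1 via the tree theorem
`theoreme1_holds`): for an EVEN number `q ≥ 1` of bricks with `2h_j ≤ h₀` and the degree condition,
`Σ_{k ≥ 0} R(k+1) = a₀ + Σ_{3 ≤ s ≤ q, s odd} a_s ζ(s)` with `a_s ∈ ℚ` (top value `ζ(q−1)` since `q` is even).
The family's normalising constants only rescale the `a_s`. [this file] -/
theorem twistBox_hasSum_oddZeta (q h₀ e : ℕ) (h : Fin q → ℕ) (hq : Even q) (hq1 : 1 ≤ q)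
    (hh : ∀ j, 2 * h j ≤ h₀)
    (hdeg : (2 * h₀ + 4 * e + 1) + (∑ j, 2 * (h j * 1)) + 2 ≤ q * (h₀ * 1 + 1)) :
    ∃ a : ℕ → ℚ, HasSum (fun k : ℕ => ((twistCore q h₀ e h ((k : ℚ) + 1) : ℚ) : ℝ))
      ((a 0 : ℝ) + ∑ s ∈ (Finset.Icc 3 q).filter Odd, (a s : ℝ) * zetaValue s) := by
  obtain ⟨a, ha⟩ := theoreme1_holds (h₀ * 1) q (twistPoly q h₀ e h) hq1
    ((Nat.add_le_add_right twistPoly_natDegree_le 2).trans hdeg) (twistPoly_symm hq)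
  have hterm : ∀ k : ℕ, (aeval ((k : ℝ) + 1) (twistPoly q h₀ e h)) / poch (k + 1) (h₀ * 1) ^ q =
      ((twistCore q h₀ e h ((k : ℚ) + 1) : ℚ) : ℝ) := by
    intro k
    have e1 : aeval ((k : ℝ) + 1) (twistPoly q h₀ e h) =
        (((twistPoly q h₀ e h).eval ((k : ℚ) + 1) : ℚ) : ℝ) := by
      have : ((k : ℝ) + 1) = algebraMap ℚ ℝ ((k : ℚ) + 1) := by rw [eq_ratCast]; push_cast; rfl
      rw [this, aeval_algebraMap_apply_eq_algebraMap_eval, eq_ratCast]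
    have e2 : poch (k + 1) (h₀ * 1) =
        ((∏ i ∈ range (h₀ * 1 + 1), (((k : ℚ) + 1) + (i : ℚ)) : ℚ) : ℝ) := by
      unfold poch; push_cast; rfl
    have hC : (∏ j, laiCof h₀ (h j) 1 ((k : ℚ) + 1)) ≠ 0 :=
      (prod_pos fun j _ => laiCof_pos h₀ (h j) 1 (by have := hh j; omega) _ (by positivity)).ne'
    have e3 : (∏ i ∈ range (h₀ * 1 + 1), (((k : ℚ) + 1) + (i : ℚ))) ^ q =
        laiDen q h₀ 1 h ((k : ℚ) + 1) * ∏ j, laiCof h₀ (h j) 1 ((k : ℚ) + 1) := by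
      rw [laiDen, ← prod_mul_distrib]
      have hc : (∏ _j : Fin q, ∏ i ∈ range (h₀ * 1 + 1), (((k : ℚ) + 1) + (i : ℚ))) =
          (∏ i ∈ range (h₀ * 1 + 1), (((k : ℚ) + 1) + (i : ℚ))) ^ q := by
        rw [prod_const, Finset.card_univ, Fintype.card_fin]
      rw [← hc]
      exact prod_congr rfl (fun j _ => by rw [poch_split h₀ (h j) 1 (hh j), mul_comm])
    rw [e1, e2, ← Rat.cast_pow, ← Rat.cast_div, e3, twistPoly_eval, twistCore, mul_div_mul_right _ _ hC]
  exact ⟨a, by simpa only [hterm] using ha⟩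

end CFR

/-! ## Sanity instances (definitions compute as intended) -/

/-- `(2t)_{3}` at `t = 1` is `2·3·4`. [this file] -/
example : twistNum 1 0 1 = 24 := by norm_num [twistNum, Finset.prod_range_succ]

/-- `(2t − 2)_{7}` at `t = 1` vanishes (the factor `i = 0`), an instance of `twistNum_natCast_eq_zero`. [this file] -/
example : twistNum 1 1 1 = 0 := by norm_num [twistNum, Finset.prod_range_succ]

/-- The smallest even design `q = 2`, `h₀ = 4`, `e = 1`, bricks `(0, 1)`: the reflection law at `t = 1/3`,
by the general theorem. [this file] -/
example : twistCore 2 4 1 ![0, 1] (-(1/3 : ℚ) - (4 : ℕ)) = -twistCore 2 4 1 ![0, 1] (1/3) :=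
  twistCore_reflect_even 2 4 1 ![0, 1] (by decide) ⟨1, rfl⟩ _

end Summit.KontsevichZagierPeriods.Zeta5Search
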